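import Literature.Analysis.FluidPDE.DuchonRobertLionsCounterexample
import HarnessLib

/-!
# `cheskidov_luo_energy_equality` is false as stated: the `t = 0` slice is junk

Refutation file (theorem-only) for the named fact
`Literature.Analysis.FluidPDE.cheskidov_luo_energy_equality` (`FluidPDE/DuchonRobert`, turb.S23;
cited there to Cheskidov–Constantin–Friedlander–Shvydkoy 2008, Thm. 1.1 and Cheskidov–Luo 2021),
the Onsager-critical sibling of the refuted `Literature.Analysis.FluidPDE.lions_energy_equality`
(`FluidPDE/DuchonRobertLionsCounterexample`). The defect is the same, word for word: the fact
concludes the energy equality `½‖u(t)‖² + ν∫₀ᵗ‖∇u‖₂² = ½‖u₀‖² + ∫₀ᵗ∫⟪f, u⟫` for **every**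
`t ∈ Icc 0 T`, and at `t = 0` this reads `kineticEnergy (u 0) = kineticEnergy u₀`, while no
clause of the accepted `Torus.IsLerayHopfOn T ν f u₀ u` constrains the time slice `u 0` (the
weak formulation, `energy_bound`, `memL2Sobolev`, `energy_ineq_ae` are integrals / a.e.
statements over `Ioo 0 T`; `weak_continuous`, `strong_initial` live on `Ioc 0 T` and along
`𝓝[>] 0`; `memLp` only asks `u 0 ∈ L²`; `energy_ineq_zero` at `t = 0` only asks
`kineticEnergy (u 0) ≤ kineticEnergy u₀`). The Besov hypothesis
`u ∈ L³(0,T; B^{1/3}_{3,c₀})` (`FunctionSpaces.MemLpBesovSupVanishing 3 (1/3) 3 u volume (Ioo 0 T)`)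
is again an a.e./integral condition over `Ioo 0 T` and does not see the slice either.

The witness is the **jump flow** of `FluidPDE/DuchonRobertLionsCounterexample`,
`t ↦ (x ↦ if t = 0 then 0 else c)` (the steady constant flow `c` with the slice `t = 0`
redefined to `0`), datum the constant field `c ≠ 0`, zero force:

* `Literature.Analysis.FluidPDE.memLpBesovSupVanishing_Ioo_self` — the guarded class
  `L^q(∅; B^s_{p,c₀})` contains every field; `Literature.Analysis.FluidPDE.memBesovSupVanishing_const`
  — constant fields lie in `B^s_{p,c₀}(T^d)` (all increments vanish);
  `Literature.Analysis.FluidPDE.memLpBesovSupVanishing_jumpFlow` — the jump flow lies in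
  `L^q(0,T; B^s_{p,c₀})` for every `T` (its slices at `t > 0` are the constant `c`);
* `Literature.Analysis.FluidPDE.not_cheskidov_luo_energy_equality` (`T = 0`, every `ν ≥ 0`,
  `c ≠ 0`; Leray–Hopf by the tree's `isLerayHopfOn_jumpFlow`) and
  `Literature.Analysis.FluidPDE.not_forall_cheskidov_luo_energy_equality` (the universal closure
  over the implicit arguments fails on `T³`, `ν = 1`);
* `Literature.Analysis.FluidPDE.not_cheskidov_luo_energy_equality_of_pos` (every `T > 0`,
  Leray–Hopf by the tree's `isLerayHopfOn_jumpFlow_of_pos`) and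
  `Literature.Analysis.FluidPDE.not_forall_cheskidov_luo_energy_equality_pos` (`T = 1`, `ν = 1`
  on `T³`): the defect is not the degenerate horizon but the unconstrained slice `u 0`.

The corrected statement is the one of the Lions sibling (`lions_energy_equality_Ioc'`,
`FluidPDE/DuchonRobertLionsEnergyEqualityGeneral`): conclusion for `t ∈ Ioc 0 T`, datum
`u₀ ∈ L²`, jointly measurable force — in the printed theorems (CCFS 2008, Thm. 1.1 for Euler;
Cheskidov–Luo 2020, Thm. 1.1 ff. for Navier–Stokes) the solution is the weakly `L²`-continuous
representative with `u(0) = u₀`, so `t = 0` is the tautology `‖u₀‖² = ‖u₀‖²`. The refuted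
record itself is kept byte-for-byte under `@[deprecated]` in `FluidPDE/DuchonRobert` (verdict
clean-up 2026-08-16), which is why `linter.deprecated` is switched off for the four theorems
below that must name it.

## References

* A. Cheskidov, P. Constantin, S. Friedlander, R. Shvydkoy, *Energy conservation and Onsager's
  conjecture for the Euler equations*, Nonlinearity 21 (2008), 1233–1252 = arXiv:0704.0759,
  Thm. 1.1 / Thm. 3.3. [CCFS2008]
* A. Cheskidov, X. Luo, *Energy equality for the Navier–Stokes equations in weak-in-time Onsager
  spaces*, Nonlinearity 33 (2020), no. 4, 1388–1403, Thm. 1.1.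
* J.-L. Lions, *Sur la régularité et l'unicité des solutions turbulentes des équations de Navier
  Stokes*, Rend. Sem. Mat. Univ. Padova 30 (1960), 16–23, Thm. 1 ("après modification éventuelle
  sur un ensemble de mesure nulle, `u` est continue de `[0,T]` dans `K`, avec `u(0) = a`").
-/

noncomputable section

open MeasureTheory TopologicalSpace Set Function Filter Topology
open scoped InnerProductSpace RealInnerProductSpace ENNReal NNReal

namespace Literature.Analysis.FluidPDE

variable {d : Type*} [Fintype d] [DecidableEq d]

/-! ### The Besov–vanishing class of the witness -/

omit [DecidableEq d] in
/-- The guarded class `L^q(∅; B^s_{p,c₀})` contains every field (a.e. membership for the zero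
measure and the `L^q`-norm in time over a null time set). [folklore] -/
theorem memLpBesovSupVanishing_Ioo_self (q : ℝ≥0∞) (s : ℝ) (p : ℝ≥0∞)
    (v : ℝ → UnitAddTorus d → EuclideanSpace ℝ d) (a : ℝ) :
    FunctionSpaces.MemLpBesovSupVanishing q s p v volume (Ioo a a) := by
  refine ⟨?_, ?_⟩
  · rw [Ioo_self, Measure.restrict_empty, ae_zero]
    exact eventually_bot
  · unfold FunctionSpaces.eLpBesovSupNorm
    rw [Ioo_self, Measure.restrict_empty, eLpNorm_measure_zero]
    exact ENNReal.zero_lt_top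

omit [DecidableEq d] in
/-- The difference quotients of a constant field vanish identically. [folklore] -/
theorem eDiffQuotient_const (s : ℝ) (p : ℝ≥0∞) (c : EuclideanSpace ℝ d) :
    FunctionSpaces.eDiffQuotient s p (fun _ : UnitAddTorus d => c) volume = fun _ => 0 := by
  ext h
  simp [FunctionSpaces.eDiffQuotient]

omit [DecidableEq d] in
/-- **Constant fields lie in `B^s_{p,c₀}(T^d)`**: they are in `L^p` of the probability space
`T^d`, their Besov sup seminorm is `0`, and the (identically zero) difference quotient tends to
`0`. [folklore] -/
theorem memBesovSupVanishing_const (s : ℝ) (p : ℝ≥0∞) (c : EuclideanSpace ℝ d) :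
    FunctionSpaces.MemBesovSupVanishing s p (fun _ : UnitAddTorus d => c) volume := by
  refine ⟨⟨memLp_const _, ?_⟩, ?_⟩
  · have h0 : FunctionSpaces.eBesovSupSeminorm s p (fun _ : UnitAddTorus d => c) volume = 0 := by
      simp [FunctionSpaces.eBesovSupSeminorm, eDiffQuotient_const]
    rw [h0]
    exact ENNReal.zero_lt_top
  · rw [eDiffQuotient_const]
    exact tendsto_const_nhds

omit [DecidableEq d] in
/-- **The jump flow lies in `L^q(0,T; B^s_{p,c₀}(T^d))`** for every horizon `T`, every
`q, s, p`: at every time `t ∈ (0, T)` its slice is the constant field `c`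
(`memBesovSupVanishing_const`), whose `B^s_{p,∞}` norm is the constant `‖c‖_{L^p}`, and a
constant real function is in `L^q` of the finite measure `volume.restrict (Ioo 0 T)`. [folklore] -/
theorem memLpBesovSupVanishing_jumpFlow (q : ℝ≥0∞) (s : ℝ) (p : ℝ≥0∞) (T : ℝ)
    (c : EuclideanSpace ℝ d) :
    FunctionSpaces.MemLpBesovSupVanishing q s p
      (fun (t : ℝ) (_ : UnitAddTorus d) => if t = 0 then (0 : EuclideanSpace ℝ d) else c) volume (Ioo 0 T) := by
  haveI : IsFiniteMeasure (volume.restrict (Ioo (0 : ℝ) T)) :=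
    ⟨by rw [Measure.restrict_apply_univ]; exact measure_Ioo_lt_top⟩
  refine ⟨?_, ?_⟩
  · filter_upwards [ae_restrict_mem measurableSet_Ioo] with t ht
    simp only [if_neg ht.1.ne']
    exact memBesovSupVanishing_const s p c
  · unfold FunctionSpaces.eLpBesovSupNorm
    have hg : (fun t : ℝ => (FunctionSpaces.eBesovSupNorm s p
          ((fun (t : ℝ) (_ : UnitAddTorus d) => if t = 0 then (0 : EuclideanSpace ℝ d) else c) t) volume).toReal)
        =ᵐ[volume.restrict (Ioo 0 T)]
        fun _ => (FunctionSpaces.eBesovSupNorm s p (fun _ : UnitAddTorus d => c) volume).toReal := by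
      filter_upwards [ae_restrict_mem measurableSet_Ioo] with t ht
      simp only [if_neg ht.1.ne']
    rw [eLpNorm_congr_ae hg]
    exact (memLp_const _).eLpNorm_lt_top

/-! ### The refutation on the degenerate horizon -/

-- names the `@[deprecated]` record `cheskidov_luo_energy_equality` of `DuchonRobert.lean` on purpose: this IS
-- its refutation (verdict clean-up 2026-08-16); REMOVE-WHEN the record is deleted from `DuchonRobert.lean`
set_option linter.deprecated false in
/-- **`cheskidov_luo_energy_equality` fails** at `T = 0`, `f = 0`, `u =` the jump flow, `u₀ = c`
for every `c ≠ 0` and `ν ≥ 0`: all hypotheses hold (`isLerayHopfOn_jumpFlow`; the Besov and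
mixed classes over `Ioo 0 0 = ∅` are trivial) while the conclusion at `t = 0 ∈ Icc 0 0` reads
`kineticEnergy 0 = kineticEnergy c`, i.e. `0 = ½‖c‖²`. [folklore] -/
theorem not_cheskidov_luo_energy_equality {c : EuclideanSpace ℝ d} (hc : c ≠ 0) {ν : ℝ} (hν : 0 ≤ ν) :
    ¬ cheskidov_luo_energy_equality (d := d) (T := 0) (ν := ν) (f := 0)
      (u := (fun (t : ℝ) (_ : UnitAddTorus d) => if t = 0 then (0 : EuclideanSpace ℝ d) else c))
      (u₀ := fun _ => c) := by
  intro h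
  have key := h (isLerayHopfOn_jumpFlow ν c) hν (memLpBesovSupVanishing_Ioo_self 3 (1 / 3) 3 _ 0)
    (memLqLp_Ioo_self 1 2 _ 0) 0 ⟨le_rfl, le_rfl⟩
  have h1 : FunctionSpaces.Torus.kineticEnergy
      ((fun (t : ℝ) (_ : UnitAddTorus d) => if t = 0 then (0 : EuclideanSpace ℝ d) else c) 0) = 0 := by
    simp [FunctionSpaces.Torus.kineticEnergy]
  have h2 : FunctionSpaces.Torus.kineticEnergy (fun _ : UnitAddTorus d => c) = 2⁻¹ * ‖c‖ ^ 2 := by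
    simp [FunctionSpaces.Torus.kineticEnergy]
  rw [h1, h2, Ioo_self, Measure.restrict_empty, lintegral_zero_measure, ENNReal.toReal_zero,
    mul_zero, zero_add, intervalIntegral.integral_same, add_zero] at key
  have : ‖c‖ ^ 2 = 0 := by linarith
  exact hc (norm_eq_zero.1 (pow_eq_zero_iff two_ne_zero |>.1 this))

-- names the `@[deprecated]` record `cheskidov_luo_energy_equality` of `DuchonRobert.lean` on purpose: this IS
-- its refutation (verdict clean-up 2026-08-16); REMOVE-WHEN the record is deleted from `DuchonRobert.lean`
set_option linter.deprecated false in
/-- **The universal closure of `cheskidov_luo_energy_equality` is false** — the statement a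
discharge `cheskidov_luo_energy_equality_holds : cheskidov_luo_energy_equality` would prove
(all implicit arguments generalised) fails on `T³` with `ν = 1`, `T = 0`, `f = 0`, datum the
unit constant field `e₀` and the jump flow. [folklore] -/
theorem not_forall_cheskidov_luo_energy_equality :
    ¬ ∀ (T ν : ℝ) (f u : ℝ → UnitAddTorus (Fin 3) → EuclideanSpace ℝ (Fin 3))
        (u₀ : UnitAddTorus (Fin 3) → EuclideanSpace ℝ (Fin 3)),
        cheskidov_luo_energy_equality (T := T) (ν := ν) (f := f) (u := u) (u₀ := u₀) := by
  intro h
  have hc : (EuclideanSpace.single (0 : Fin 3) (1 : ℝ)) ≠ 0 := fun h0 => by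
    have h1 := congrArg (fun v : EuclideanSpace ℝ (Fin 3) => v 0) h0
    simp at h1
  exact not_cheskidov_luo_energy_equality hc zero_le_one (h 0 1 0 _ _)

/-! ### Positive horizons -/

-- names the `@[deprecated]` record `cheskidov_luo_energy_equality` of `DuchonRobert.lean` on purpose: this IS
-- its refutation (verdict clean-up 2026-08-16); REMOVE-WHEN the record is deleted from `DuchonRobert.lean`
set_option linter.deprecated false in
/-- **`cheskidov_luo_energy_equality` fails on every positive horizon**: for `T > 0`, `ν ≥ 0`,
`c ≠ 0` the instance `f = 0`, `u =` the jump flow, `u₀ = c` is false — the hypotheses hold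
(`isLerayHopfOn_jumpFlow_of_pos`, `memLpBesovSupVanishing_jumpFlow`, the zero force lies in
`L¹(0,T; L²)`), while the conclusion at `t = 0 ∈ Icc 0 T` reads `0 = ½‖c‖²`. [folklore] -/
theorem not_cheskidov_luo_energy_equality_of_pos {T : ℝ} (hT : 0 < T) {c : EuclideanSpace ℝ d}
    (hc : c ≠ 0) {ν : ℝ} (hν : 0 ≤ ν) :
    ¬ cheskidov_luo_energy_equality (d := d) (T := T) (ν := ν) (f := 0)
      (u := (fun (t : ℝ) (_ : UnitAddTorus d) => if t = 0 then (0 : EuclideanSpace ℝ d) else c))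
      (u₀ := fun _ => c) := by
  intro h
  -- `f = 0 ∈ L¹(0,T; L²)`
  have hf : Torus.MemLqLp 1 2 (0 : ℝ → UnitAddTorus d → EuclideanSpace ℝ d) (Ioo 0 T) := by
    refine ⟨ae_of_all _ fun t => ?_, ?_⟩
    · rw [Pi.zero_apply]
      exact MemLp.zero
    · rw [FluidPDE.eLqLpNorm_zero]
      exact ENNReal.zero_lt_top
  have key := h (isLerayHopfOn_jumpFlow_of_pos hT ν c) hν
    (memLpBesovSupVanishing_jumpFlow 3 (1 / 3) 3 T c) hf 0 ⟨le_rfl, hT.le⟩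
  have h1 : FunctionSpaces.Torus.kineticEnergy
      ((fun (t : ℝ) (_ : UnitAddTorus d) => if t = 0 then (0 : EuclideanSpace ℝ d) else c) 0) = 0 := by
    simp [FunctionSpaces.Torus.kineticEnergy]
  have h2 : FunctionSpaces.Torus.kineticEnergy (fun _ : UnitAddTorus d => c) = 2⁻¹ * ‖c‖ ^ 2 := by
    simp [FunctionSpaces.Torus.kineticEnergy]
  rw [h1, h2, Ioo_self, Measure.restrict_empty, lintegral_zero_measure, ENNReal.toReal_zero,
    mul_zero, zero_add, intervalIntegral.integral_same, add_zero] at key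
  have : ‖c‖ ^ 2 = 0 := by linarith
  exact hc (norm_eq_zero.1 (pow_eq_zero_iff two_ne_zero |>.1 this))

-- names the `@[deprecated]` record `cheskidov_luo_energy_equality` of `DuchonRobert.lean` on purpose: this IS
-- its refutation (verdict clean-up 2026-08-16); REMOVE-WHEN the record is deleted from `DuchonRobert.lean`
set_option linter.deprecated false in
/-- **The universal closure fails on every positive horizon too**: on `T³` with `ν = 1`, `T = 1`,
`f = 0`, the jump flow and the unit constant datum. [folklore] -/
theorem not_forall_cheskidov_luo_energy_equality_pos :
    ¬ ∀ (f u : ℝ → UnitAddTorus (Fin 3) → EuclideanSpace ℝ (Fin 3))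
        (u₀ : UnitAddTorus (Fin 3) → EuclideanSpace ℝ (Fin 3)),
        cheskidov_luo_energy_equality (T := 1) (ν := 1) (f := f) (u := u) (u₀ := u₀) := by
  intro h
  have hc : (EuclideanSpace.single (0 : Fin 3) (1 : ℝ)) ≠ 0 := fun h0 => by
    have h1 := congrArg (fun v : EuclideanSpace ℝ (Fin 3) => v 0) h0
    simp at h1
  exact not_cheskidov_luo_energy_equality_of_pos one_pos hc zero_le_one (h 0 _ _)

end Literature.Analysis.FluidPDE

end
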